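import Literature.NumberTheory.EllipticCurves.ModularCurve
import Mathlib.Data.ZMod.Units
import HarnessLib

/-!
# The cusps of `Γ₀(N)` (trunk EllArithM, item C17; discharge of a named fact)

This file proves, sorry-free and unconditionally, the named fact
`Literature.ModularForms.numCusps_eq_nuInfty N` of
`Literature.NumberTheory.EllipticCurves.ModularCurve` for every `N ≥ 1`:

  `ε_∞(Γ₀(N)) = #(Γ₀(N) \ ℙ¹(ℚ)) = ∑_{d ∣ N} φ(gcd(d, N/d))`

(Shimura Prop. 1.43, second assertion; Diamond–Shurman §3.8, p. 103), as
`numCusps_eq_nuInfty_holds`. It is item 3 of the DAG below the dimension formula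
`dim S₂(Γ₀(N)) = g(X₀(N))` (`finrank_cuspForm_two_eq_genusX0`, Diamond–Shurman Thm. 3.5.1), see
`Literature.NumberTheory.EllipticCurves.ModularCurveProofs`.

## Proof

Mathlib's `CuspOrbits 𝒢` (for `𝒢` the image of `Γ₀(N)` in `GL(2, ℝ)`) is the set of
`Γ₀(N)`-orbits of cusps, and the cusps of an arithmetic group are the points `g ∞`,
`g ∈ SL₂(ℤ)` (Mathlib `isCusp_SL2Z_iff'`), so `g ↦ Γ₀(N) g ∞` is a surjection
`SL₂(ℤ) → CuspOrbits 𝒢` (`cuspOrbitOf_surjective`) identifying `g`, `g'` iff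
`g' ∈ Γ₀(N) g P`, `P = SL₂(ℤ)_∞ = {±(1 m; 0 1)}` (`cuspOrbitOf_eq_iff`). Following
Diamond–Shurman §3.8 (Prop. 3.8.3 and the discussion on p. 103) we attach to
`g = (a b; c d₀) ∈ SL₂(ℤ)`, i.e. to the cusp `a/c` in lowest terms, the invariant

  `cuspInv N g = (d, a · (c/d) mod gcd(d, N/d))`, `d = gcd(c, N)`,

with values in the finite set `CuspIndex N = ∐_{d ∣ N} (ℤ/gcd(d, N/d)ℤ)ˣ` of cardinality
`∑_{d ∣ N} φ(gcd(d, N/d))` (`card_cuspIndex`), and check by elementary congruences that it is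
constant on double cosets `Γ₀(N) g P` (`cuspInv_mul_left`, `cuspInv_mul_right`), separates them
(`exists_mem_gamma0_of_cuspInv_eq`: if the invariants of `g`, `g'` agree there is `m` with
`g (1 m; 0 1) g'⁻¹ ∈ Γ₀(N)`, i.e. `c d₀' − c' d₀ ≡ m c c' (mod N)`, the criterion of Cremona,
*Algorithms for modular elliptic curves*, Prop. 2.2.3), and is onto (`cuspInv_surjective`).
Hence `CuspOrbits 𝒢` and `CuspIndex N` are quotients of `SL₂(ℤ)` by the same relation and
`numCusps N = #CuspIndex N = ∑_{d ∣ N} φ(gcd(d, N/d)) = nuInfty N`.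

Only theorems and the two auxiliary definitions `CuspIndex`, `cuspInv` (with its components
`cuspDivisor`, `cuspUnitInt`, and `cuspOf`/`cuspOrbitOf` naming Mathlib objects) are added; no new
facts. Everything is in `namespace Literature.ModularForms` like `ModularCurve.lean`.

## References

* G. Shimura, *Introduction to the arithmetic theory of automorphic functions*, Princeton (1971),
  §1.6, Prop. 1.43 (index and number of cusps of `Γ₀(N)`), p. 25.
* F. Diamond, J. Shurman, *A first course in modular forms*, GTM 228, Springer (2005), §3.8:
  Lemma 3.8.1, Prop. 3.8.3, and the count `ε_∞(Γ₀(N)) = ∑_{d ∣ N} φ(gcd(d, N/d))`, p. 103.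
* J. E. Cremona, *Algorithms for modular elliptic curves*, 2nd ed., CUP (1997), §2.2,
  Prop. 2.2.3 (equivalence of cusps modulo `Γ₀(N)`).
-/

noncomputable section

open scoped MatrixGroups

open CongruenceSubgroup Matrix Matrix.SpecialLinearGroup OnePoint

namespace Literature.NumberTheory.EllipticCurves.ModularForms

/-! ### The index set `∐_{d ∣ N} (ℤ/gcd(d, N/d)ℤ)ˣ` -/

section CuspIndex

variable (N : ℕ)

/-- The classical index set for the cusps of `Γ₀(N)`: pairs `(d, u)` with `d` a positive divisor
of `N` and `u ∈ (ℤ/gcd(d, N/d)ℤ)ˣ`. The cusp `a/c` of `Γ₀(N)` (lowest terms) corresponds to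
`d = gcd(c, N)` and `u = a · (c/d) mod gcd(d, N/d)`; for each `d ∣ N` there are exactly
`φ(gcd(d, N/d))` cusps with `gcd(c, N) = d` (Diamond–Shurman §3.8, p. 103; Shimura Prop. 1.43).
[cite: DiamondShurman2005, §3.8] -/
def CuspIndex : Type :=
  Σ d : N.divisors, (ZMod (Nat.gcd d (N / d)))ˣ

variable {N}

/-- The element `(d, r mod gcd(d, N/d))` of `CuspIndex N`, for `d ∣ N` and an integer `r` prime to
`gcd(d, N/d)`. [folklore] -/
def CuspIndex.mk (d : ℕ) (hd : d ∈ N.divisors) (r : ℤ)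
    (hr : IsCoprime r (Nat.gcd d (N / d) : ℕ)) : CuspIndex N :=
  ⟨⟨d, hd⟩, ((ZMod.coe_int_isUnit_iff_isCoprime r (Nat.gcd d (N / d))).mpr hr.symm).unit⟩

/-- Two elements `(d, r̄)`, `(d', r̄')` of `CuspIndex N` are equal iff `d = d'` and
`r ≡ r' (mod gcd(d, N/d))`. [folklore] -/
theorem CuspIndex.mk_eq_mk_iff {d d' : ℕ} {hd : d ∈ N.divisors} {hd' : d' ∈ N.divisors} {r r' : ℤ}
    {hr : IsCoprime r (Nat.gcd d (N / d) : ℕ)} {hr' : IsCoprime r' (Nat.gcd d' (N / d') : ℕ)} :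
    CuspIndex.mk d hd r hr = CuspIndex.mk d' hd' r' hr' ↔
      d = d' ∧ (r : ZMod (Nat.gcd d (N / d))) = r' := by
  constructor
  · intro h
    obtain rfl : d = d' := congrArg (fun x : CuspIndex N ↦ (x.1 : ℕ)) h
    refine ⟨rfl, ?_⟩
    have h2 := congrArg Units.val (eq_of_heq (Sigma.mk.inj_iff.mp h).2)
    rwa [IsUnit.unit_spec, IsUnit.unit_spec] at h2
  · rintro ⟨rfl, h⟩
    refine Sigma.ext rfl (heq_of_eq <| Units.ext ?_)
    dsimp only [CuspIndex.mk]
    rw [IsUnit.unit_spec, IsUnit.unit_spec]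
    exact h

/-- Every element of `CuspIndex N` is of the form `CuspIndex.mk d _ r _` with `r` the canonical
representative of its unit component. [folklore] -/
theorem CuspIndex.mk_val_eq (x : CuspIndex N) (hr) :
    CuspIndex.mk (x.1 : ℕ) x.1.2 ((x.2 : ZMod (Nat.gcd x.1 (N / x.1))).val : ℤ) hr = x := by
  obtain ⟨⟨d, hd⟩, u⟩ := x
  haveI : NeZero (Nat.gcd d (N / d)) :=
    ⟨Nat.gcd_ne_zero_left (Nat.pos_of_mem_divisors hd).ne'⟩
  refine Sigma.ext rfl (heq_of_eq <| Units.ext ?_)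
  dsimp only [CuspIndex.mk]
  rw [IsUnit.unit_spec]
  push_cast
  exact ZMod.natCast_zmod_val _

variable (N)

/-- **`#CuspIndex N = ∑_{d ∣ N} φ(gcd(d, N/d))`** (`= nuInfty N`), since `#(ℤ/eℤ)ˣ = φ(e)` for
`e ≥ 1` (Diamond–Shurman §3.8, p. 103). [folklore] -/
theorem card_cuspIndex : Nat.card (CuspIndex N) = nuInfty N := by
  have hne : ∀ d : N.divisors, NeZero (Nat.gcd d (N / d)) := fun d ↦
    ⟨Nat.gcd_ne_zero_left (Nat.pos_of_mem_divisors d.2).ne'⟩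
  unfold CuspIndex nuInfty
  rw [Nat.card_sigma, ← Finset.sum_coe_sort N.divisors]
  refine Finset.sum_congr rfl fun d _ ↦ ?_
  rw [Nat.card_eq_fintype_card, ZMod.card_units_eq_totient]

end CuspIndex

/-! ### Two congruence computations -/

section Congruences

/-- The invariant `a · (c/d) mod gcd(d, n)` (`N = dn`, `d = gcd(c, N)`, `c = d c₁`) does not change
under `(a, c) ↦ (αa + βc, κa + δc)` for `(α β; κ δ) ∈ Γ₀(N)` (`N ∣ κ`, `αδ − βκ = 1`): modulo
`e = gcd(d, n)` one has `βc ≡ 0`, `(κa + δc)/d = nκ₁a + δc₁ ≡ δc₁` and `αδ ≡ 1`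
(Diamond–Shurman §3.8, proof of Prop. 3.8.3). [folklore] -/
theorem cusp_congr_left {d n : ℕ} (hd : d ≠ 0) {a α β δ c₁ κ₁ : ℤ}
    (hdet : α * δ - β * ((d * n : ℕ) * κ₁) = 1) :
    (((α * a + β * (d * c₁)) * (((d * n : ℕ) * κ₁ * a + δ * (d * c₁)) / d) : ℤ) :
        ZMod (Nat.gcd d n)) = (a * (d * c₁ / d) : ℤ) := by
  have hd' : (d : ℤ) ≠ 0 := by exact_mod_cast hd
  have h1 : ((d * n : ℕ) * κ₁ * a + δ * (d * c₁)) / (d : ℤ) = n * κ₁ * a + δ * c₁ :=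
    Int.ediv_eq_of_eq_mul_right hd' (by push_cast; ring)
  have h2 : (d : ℤ) * c₁ / d = c₁ := Int.mul_ediv_cancel_left _ hd'
  rw [h1, h2]
  have hd0 : ((d : ℕ) : ZMod (Nat.gcd d n)) = 0 :=
    (ZMod.natCast_eq_zero_iff _ _).mpr (Nat.gcd_dvd_left _ _)
  have hn0 : ((n : ℕ) : ZMod (Nat.gcd d n)) = 0 :=
    (ZMod.natCast_eq_zero_iff _ _).mpr (Nat.gcd_dvd_right _ _)
  have hdet' := congrArg (Int.cast : ℤ → ZMod (Nat.gcd d n)) hdet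
  push_cast at hdet' ⊢
  rw [hd0, hn0] at *
  linear_combination (a * c₁) * hdet'

/-- The key step of the count (Diamond–Shurman §3.8, p. 103; Cremona Prop. 2.2.3): if
`g = (a b; dc₁ d₀)` and `g' = (a' b'; dc₁' d₀')` in `SL₂(ℤ)` have `gcd(c₁, n) = gcd(c₁', n) = 1`
and `a c₁ ≡ a' c₁' (mod gcd(d, n))`, then `c d₀' − c' d₀ ≡ m c c' (mod dn)` for some `m`
(`c = dc₁`, `c' = dc₁'`), i.e. `g (1 m; 0 1) g'⁻¹ ∈ Γ₀(dn)`. Proof: with `w, w'` inverses of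
`c₁, c₁'` modulo `n`, `a d₀ ≡ a' d₀' ≡ 1 (mod e)` gives `d₀ w ≡ d₀' w' (mod e)`, `e = gcd(d, n) =
xd + yn`, so `d₀ w − d₀' w' ≡ x t d (mod n)` for some `t`, and `m = −xt` works. [folklore] -/
theorem cusp_congr_exists {d n : ℕ} {a b c₁ d₀ a' b' c₁' d₀' : ℤ}
    (hdet : a * d₀ - b * (d * c₁) = 1) (hdet' : a' * d₀' - b' * (d * c₁') = 1)
    (hc₁ : IsCoprime c₁ n) (hc₁' : IsCoprime c₁' n)
    (h : ((a * c₁ : ℤ) : ZMod (Nat.gcd d n)) = (a' * c₁' : ℤ)) :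
    ∃ m : ℤ, ((d * n : ℕ) : ℤ) ∣ d * c₁ * d₀' - d * c₁' * d₀ - m * (d * c₁) * (d * c₁') := by
  -- inverses of `c₁, c₁'` modulo `n`
  obtain ⟨w, k, hw⟩ : ∃ w k : ℤ, c₁ * w = 1 + n * k := by
    obtain ⟨u, v, huv⟩ := hc₁
    exact ⟨u, -v, by linear_combination huv⟩
  obtain ⟨w', k', hw'⟩ : ∃ w k : ℤ, c₁' * w = 1 + n * k := by
    obtain ⟨u, v, huv⟩ := hc₁'
    exact ⟨u, -v, by linear_combination huv⟩
  set e : ℕ := Nat.gcd d n with he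
  have hd0 : ((d : ℕ) : ZMod e) = 0 := (ZMod.natCast_eq_zero_iff _ _).mpr (Nat.gcd_dvd_left _ _)
  have hn0 : ((n : ℕ) : ZMod e) = 0 := (ZMod.natCast_eq_zero_iff _ _).mpr (Nat.gcd_dvd_right _ _)
  -- `d₀ w ≡ d₀' w' (mod e)`
  have H1 : (e : ℤ) ∣ d₀ * w - d₀' * w' := by
    rw [← ZMod.intCast_zmod_eq_zero_iff_dvd]
    have h₁ := congrArg (Int.cast : ℤ → ZMod e) hdet
    have h₂ := congrArg (Int.cast : ℤ → ZMod e) hdet'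
    have h₃ := congrArg (Int.cast : ℤ → ZMod e) hw
    have h₄ := congrArg (Int.cast : ℤ → ZMod e) hw'
    push_cast at h h₁ h₂ h₃ h₄ ⊢
    rw [hd0] at h₁ h₂
    rw [hn0] at h₃ h₄
    linear_combination (d₀' * w' * c₁ * w) * h₁ + (-(d₀ * w * c₁' * w')) * h₂ + (d₀' * w') * h₃ +
      (-(d₀ * w)) * h₄ + (-(d₀ * d₀' * w * w')) * h
  obtain ⟨t, ht⟩ := H1
  -- Bezout for `e = gcd(d, n)`
  have hbez : (e : ℤ) = d * Nat.gcdA d n + n * Nat.gcdB d n := Nat.gcd_eq_gcd_ab d n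
  set x := Nat.gcdA d n
  set y := Nat.gcdB d n
  refine ⟨-(x * t), ?_⟩
  have key : (n : ℤ) ∣ c₁ * d₀' - c₁' * d₀ + x * t * d * c₁ * c₁' := by
    rw [← ZMod.intCast_zmod_eq_zero_iff_dvd]
    have h₃ := congrArg (Int.cast : ℤ → ZMod n) hw
    have h₄ := congrArg (Int.cast : ℤ → ZMod n) hw'
    rw [hbez] at ht
    have h₅ := congrArg (Int.cast : ℤ → ZMod n) ht
    push_cast at h₃ h₄ h₅ ⊢
    rw [ZMod.natCast_self] at h₃ h₄ h₅
    linear_combination (c₁' * d₀) * h₃ + (-(c₁ * d₀')) * h₄ + (-(c₁ * c₁')) * h₅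
  have : (d : ℤ) * c₁ * d₀' - d * c₁' * d₀ - -(x * t) * (d * c₁) * (d * c₁') =
      d * (c₁ * d₀' - c₁' * d₀ + x * t * d * c₁ * c₁') := by ring
  rw [this, Nat.cast_mul]
  exact mul_dvd_mul_left _ key

end Congruences

/-! ### The invariant of a cusp -/

section Invariant

variable (N : ℕ)

/-- `d(g) = gcd(c, N)` for `g = (a b; c d₀) ∈ SL₂(ℤ)`: the divisor of `N` attached to the cusp
`g ∞ = a/c` (Diamond–Shurman §3.8, p. 103). [folklore] -/
def cuspDivisor (g : SL(2, ℤ)) : ℕ :=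
  Int.gcd (g 1 0) N

/-- `d(g) ∣ N`. [folklore] -/
theorem cuspDivisor_dvd (g : SL(2, ℤ)) : cuspDivisor N g ∣ N :=
  Int.natCast_dvd_natCast.mp (Int.gcd_dvd_right (g 1 0) N)

/-- `d(g) ∣ c`. [folklore] -/
theorem cuspDivisor_dvd_apply (g : SL(2, ℤ)) : (cuspDivisor N g : ℤ) ∣ g 1 0 :=
  Int.gcd_dvd_left _ _

/-- `d(g)` only depends on the bottom-left entry `c`. [folklore] -/
theorem cuspDivisor_congr {g g' : SL(2, ℤ)} (h : g 1 0 = g' 1 0) :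
    cuspDivisor N g = cuspDivisor N g' := by
  rw [cuspDivisor, cuspDivisor, h]

/-- The integer `r(g) = a · (c / d(g))` for `g = (a b; c d₀) ∈ SL₂(ℤ)`; its class modulo
`gcd(d, N/d)` is the unit component of the invariant of the cusp `g ∞ = a/c`
(Diamond–Shurman §3.8, p. 103). [folklore] -/
def cuspUnitInt (g : SL(2, ℤ)) : ℤ :=
  g 0 0 * (g 1 0 / cuspDivisor N g)

/-- The entries `a`, `c` of `g = (a b; c d₀) ∈ SL₂(ℤ)` are coprime. [folklore] -/
theorem isCoprime_apply (g : SL(2, ℤ)) : IsCoprime (g 0 0) (g 1 0) := by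
  have hdet := g.det_coe
  rw [Matrix.det_fin_two] at hdet
  exact ⟨g 1 1, -g 0 1, by linear_combination hdet⟩

variable [NeZero N]

/-- `d(g) ≠ 0` (as `N ≠ 0`). [folklore] -/
theorem cuspDivisor_ne_zero (g : SL(2, ℤ)) : cuspDivisor N g ≠ 0 := fun h ↦
  NeZero.ne N (by exact_mod_cast (Int.gcd_eq_zero_iff.mp h).2)

/-- `d(g)` is a positive divisor of `N`. [folklore] -/
theorem cuspDivisor_mem_divisors (g : SL(2, ℤ)) : cuspDivisor N g ∈ N.divisors :=
  Nat.mem_divisors.mpr ⟨cuspDivisor_dvd N g, NeZero.ne N⟩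

/-- `c / d(g)` is prime to `N / d(g)`. [folklore] -/
theorem isCoprime_div_cuspDivisor (g : SL(2, ℤ)) :
    IsCoprime (g 1 0 / cuspDivisor N g) ((N / cuspDivisor N g : ℕ) : ℤ) := by
  rw [Int.isCoprime_iff_gcd_eq_one, Int.natCast_div]
  exact Int.gcd_div_gcd_div_gcd (Nat.pos_of_ne_zero (cuspDivisor_ne_zero N g))

/-- `r(g)` is prime to `gcd(d(g), N/d(g))`: `a` is prime to `c`, hence to `d ∣ c`, and `c/d` is
prime to `N/d` (Diamond–Shurman §3.8). [folklore] -/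
theorem isCoprime_cuspUnitInt (g : SL(2, ℤ)) :
    IsCoprime (cuspUnitInt N g) (Nat.gcd (cuspDivisor N g) (N / cuspDivisor N g) : ℕ) := by
  refine IsCoprime.mul_left ?_ ?_
  · refine ((isCoprime_apply g).of_isCoprime_of_dvd_right
      (cuspDivisor_dvd_apply N g)).of_isCoprime_of_dvd_right ?_
    exact_mod_cast Nat.gcd_dvd_left _ _
  · refine (isCoprime_div_cuspDivisor N g).of_isCoprime_of_dvd_right ?_
    exact_mod_cast Nat.gcd_dvd_right _ _

/-- **The invariant of the cusp `g ∞`** with respect to `Γ₀(N)`: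
`g = (a b; c d₀) ↦ (d, a · (c/d) mod gcd(d, N/d))`, `d = gcd(c, N)` (Diamond–Shurman §3.8,
p. 103: a cusp `a/c` of `Γ₀(N)` is determined by `d = gcd(c, N)` together with a unit modulo
`gcd(d, N/d)`). [cite: DiamondShurman2005, §3.8] -/
def cuspInv (g : SL(2, ℤ)) : CuspIndex N :=
  CuspIndex.mk (cuspDivisor N g) (cuspDivisor_mem_divisors N g) (cuspUnitInt N g)
    (isCoprime_cuspUnitInt N g)

/-- The invariant only depends on the first column `(a, c)` of `g`, i.e. on the cusp
`g ∞ = a/c` together with the sign of `(a, c)`. [folklore] -/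
theorem cuspInv_congr {g g' : SL(2, ℤ)} (h₀ : g 0 0 = g' 0 0) (h₁ : g 1 0 = g' 1 0) :
    cuspInv N g = cuspInv N g' := by
  rw [cuspInv, cuspInv, CuspIndex.mk_eq_mk_iff]
  refine ⟨cuspDivisor_congr N h₁, ?_⟩
  rw [cuspUnitInt, cuspUnitInt, cuspDivisor_congr N h₁, h₀, h₁]

/-- The invariant does not see the sign: `cuspInv N (−g) = cuspInv N g`. [folklore] -/
theorem cuspInv_neg (g : SL(2, ℤ)) : cuspInv N (-g) = cuspInv N g := by
  have hd : cuspDivisor N (-g) = cuspDivisor N g := by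
    simp [cuspDivisor, Int.neg_gcd]
  rw [cuspInv, cuspInv, CuspIndex.mk_eq_mk_iff]
  refine ⟨hd, ?_⟩
  rw [cuspUnitInt, cuspUnitInt, hd]
  simp [Int.neg_ediv_of_dvd (cuspDivisor_dvd_apply N g)]

/-- **Left invariance**: `cuspInv N (γ g) = cuspInv N g` for `γ ∈ Γ₀(N)` (the invariant is a
function of the cusp orbit `Γ₀(N) g ∞`; Diamond–Shurman Prop. 3.8.3). [folklore] -/
theorem cuspInv_mul_left {γ : SL(2, ℤ)} (hγ : γ ∈ Gamma0 N) (g : SL(2, ℤ)) :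
    cuspInv N (γ * g) = cuspInv N g := by
  obtain ⟨κ₀, hκ⟩ : (N : ℤ) ∣ γ 1 0 := (ZMod.intCast_zmod_eq_zero_iff_dvd _ _).mp (Gamma0_mem.mp hγ)
  have hdetγ := γ.det_coe
  rw [Matrix.det_fin_two, hκ] at hdetγ
  -- entries of `γ g`
  have h00 : (γ * g) 0 0 = γ 0 0 * g 0 0 + γ 0 1 * g 1 0 := by
    simp [Matrix.mul_apply, Fin.sum_univ_two]
  have h10 : (γ * g) 1 0 = γ 1 0 * g 0 0 + γ 1 1 * g 1 0 := by
    simp [Matrix.mul_apply, Fin.sum_univ_two]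
  -- Step 1: `gcd(κ a + δ c, N) = gcd(c, N)`
  have hd : cuspDivisor N (γ * g) = cuspDivisor N g := by
    rw [cuspDivisor, cuspDivisor, h10, hκ]
    have : (N : ℤ) * κ₀ * g 0 0 + γ 1 1 * g 1 0 = γ 1 1 * g 1 0 + N * (κ₀ * g 0 0) := by ring
    rw [this, Int.gcd_add_mul_left_left]
    have hδ : IsCoprime (γ 1 1) (N : ℤ) := ⟨γ 0 0, -(γ 0 1 * κ₀), by linear_combination hdetγ⟩
    rw [Int.isCoprime_iff_gcd_eq_one, Int.gcd_eq_natAbs, Int.natAbs_natCast] at hδ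
    rw [Int.gcd_eq_natAbs, Int.natAbs_mul, Int.natAbs_natCast, Nat.Coprime.gcd_mul_left_cancel _ hδ,
      Int.gcd_eq_natAbs, Int.natAbs_natCast]
  rw [cuspInv, cuspInv, CuspIndex.mk_eq_mk_iff]
  refine ⟨hd, ?_⟩
  rw [cuspUnitInt, cuspUnitInt, hd, h00, h10, hκ]
  -- Step 2: the congruence `cusp_congr_left`
  set d := cuspDivisor N g with hd_def
  obtain ⟨c₁, hc₁⟩ := cuspDivisor_dvd_apply N g
  have hNd : N = d * (N / d) := (Nat.mul_div_cancel' (cuspDivisor_dvd N g)).symm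
  rw [hc₁]
  have hN' : (N : ℤ) * κ₀ = ((d * (N / d) : ℕ) : ℤ) * κ₀ := by rw [← hNd]
  rw [hN']
  refine cusp_congr_left (cuspDivisor_ne_zero N g) ?_
  rw [← hNd]
  exact hdetγ

/-- **Right invariance**: `cuspInv N (g p) = cuspInv N g` for `p ∈ SL₂(ℤ)_∞ = {±(1 m; 0 1)}`
(`p ∞ = ∞`; the first column of `g p` is `±` that of `g`). [folklore] -/
theorem cuspInv_mul_right (g : SL(2, ℤ)) {p : SL(2, ℤ)} (hp : p 1 0 = 0) :
    cuspInv N (g * p) = cuspInv N g := by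
  have hdet := p.det_coe
  rw [Matrix.det_fin_two, hp, mul_zero, sub_zero] at hdet
  have h00 : (g * p) 0 0 = g 0 0 * p 0 0 := by simp [Matrix.mul_apply, Fin.sum_univ_two, hp]
  have h10 : (g * p) 1 0 = g 1 0 * p 0 0 := by simp [Matrix.mul_apply, Fin.sum_univ_two, hp]
  rcases Int.eq_one_or_neg_one_of_mul_eq_one' hdet with ⟨h1, -⟩ | ⟨h1, -⟩
  · exact cuspInv_congr N (by rw [h00, h1, mul_one]) (by rw [h10, h1, mul_one])
  · rw [← cuspInv_neg N g]
    exact cuspInv_congr N (by rw [h00, h1]; simp) (by rw [h10, h1]; simp)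

/-- **Separation** (Diamond–Shurman Prop. 3.8.3 for `Γ₀(N)`; Cremona Prop. 2.2.3): if the cusps
`g ∞`, `g' ∞` have the same invariant then `g' ∈ Γ₀(N) g SL₂(ℤ)_∞`, i.e. there is
`γ ∈ Γ₀(N)` with `g⁻¹ γ g' ∞ = ∞`; namely `γ = g (1 m; 0 1) g'⁻¹` with `m` from
`cusp_congr_exists`. [cite: DiamondShurman2005, Prop. 3.8.3] -/
theorem exists_mem_gamma0_of_cuspInv_eq {g g' : SL(2, ℤ)} (h : cuspInv N g = cuspInv N g') :
    ∃ γ ∈ Gamma0 N, (g⁻¹ * γ * g') 1 0 = 0 := by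
  rw [cuspInv, cuspInv, CuspIndex.mk_eq_mk_iff] at h
  obtain ⟨hd, hu⟩ := h
  rw [cuspUnitInt, cuspUnitInt, ← hd] at hu
  set d := cuspDivisor N g with hd_def
  have hd0 : d ≠ 0 := cuspDivisor_ne_zero N g
  have hd0' : (d : ℤ) ≠ 0 := by exact_mod_cast hd0
  obtain ⟨c₁, hc₁⟩ := cuspDivisor_dvd_apply N g
  obtain ⟨c₁', hc₁'⟩ : (d : ℤ) ∣ g' 1 0 := hd ▸ cuspDivisor_dvd_apply N g'
  have hNd : N = d * (N / d) := (Nat.mul_div_cancel' (cuspDivisor_dvd N g)).symm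
  set n := N / d with hn_def
  -- coprimality of `c₁, c₁'` with `n`
  have hcop : IsCoprime c₁ n := by
    have := isCoprime_div_cuspDivisor N g
    rwa [← hd_def, hc₁, Int.mul_ediv_cancel_left _ hd0'] at this
  have hcop' : IsCoprime c₁' n := by
    have := isCoprime_div_cuspDivisor N g'
    rwa [← hd, hc₁', Int.mul_ediv_cancel_left _ hd0'] at this
  -- determinants
  have hdet := g.det_coe
  have hdet' := g'.det_coe
  rw [Matrix.det_fin_two] at hdet hdet'
  rw [hc₁] at hdet
  rw [hc₁'] at hdet'
  rw [hc₁, hc₁', Int.mul_ediv_cancel_left _ hd0', Int.mul_ediv_cancel_left _ hd0'] at hu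
  obtain ⟨m, hm⟩ := cusp_congr_exists hdet hdet' hcop hcop' hu
  rw [← hNd] at hm
  -- the element `γ = g (1 m; 0 1) g'⁻¹`
  let T : SL(2, ℤ) := ⟨!![1, m; 0, 1], by simp [Matrix.det_fin_two_of]⟩
  refine ⟨g * T * g'⁻¹, ?_, ?_⟩
  · rw [Gamma0_mem, ZMod.intCast_zmod_eq_zero_iff_dvd]
    rw [SL2_inv_expl]
    simp only [coe_mul, mul_apply, Fin.sum_univ_two, T, of_apply, cons_val', cons_val_zero,
      cons_val_one, empty_val', cons_val_fin_one]
    rw [hc₁, hc₁']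
    convert hm using 1
    ring
  · have : g⁻¹ * (g * T * g'⁻¹) * g' = T := by group
    rw [this]
    simp [T]

/-- **Every index is the invariant of a cusp**: given `d ∣ N` and a unit `u` modulo
`gcd(d, N/d)`, lift `u` to a unit `a` modulo `d` (Mathlib `ZMod.unitsMap_surjective`) and complete
the coprime column `(a, d)` to `g ∈ SL₂(ℤ)`; then `cuspInv N g = (d, u)` (Diamond–Shurman §3.8,
p. 103). [folklore] -/
theorem cuspInv_surjective : Function.Surjective (cuspInv N) := by
  rintro ⟨⟨d, hd⟩, u⟩
  have hdN : d ∣ N := Nat.dvd_of_mem_divisors hd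
  have hd0 : d ≠ 0 := (Nat.pos_of_mem_divisors hd).ne'
  haveI : NeZero d := ⟨hd0⟩
  haveI : NeZero (Nat.gcd d (N / d)) := ⟨Nat.gcd_ne_zero_left hd0⟩
  have he : Nat.gcd d (N / d) ∣ d := Nat.gcd_dvd_left _ _
  obtain ⟨v, hv⟩ := ZMod.unitsMap_surjective he u
  have hcop : IsCoprime (((v : ZMod d).val : ℕ) : ℤ) (d : ℤ) :=
    Nat.isCoprime_iff_coprime.mpr (ZMod.val_coe_unit_coprime v)
  obtain ⟨x, y, hxy⟩ := hcop
  let g : SL(2, ℤ) := ⟨!![(((v : ZMod d).val : ℕ) : ℤ), -y; (d : ℤ), x], by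
    rw [Matrix.det_fin_two_of]; linear_combination hxy⟩
  have hdg : cuspDivisor N g = d := by
    simp only [cuspDivisor, g, of_apply, cons_val', cons_val_zero, cons_val_one, empty_val',
      cons_val_fin_one, Int.gcd_natCast_natCast]
    exact Nat.gcd_eq_left hdN
  refine ⟨g, ?_⟩
  have hr' : IsCoprime (((u : ZMod (Nat.gcd d (N / d))).val : ℕ) : ℤ) (Nat.gcd d (N / d) : ℕ) :=
    ((ZMod.coe_int_isUnit_iff_isCoprime _ _).mp (by
      push_cast
      rw [ZMod.natCast_zmod_val]
      exact Units.isUnit _)).symm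
  refine Eq.trans ?_ (CuspIndex.mk_val_eq (N := N) ⟨⟨d, hd⟩, u⟩ hr')
  rw [cuspInv, CuspIndex.mk_eq_mk_iff]
  refine ⟨hdg, ?_⟩
  rw [cuspUnitInt, hdg]
  change (((((v : ZMod d).val : ℕ) : ℤ) * ((d : ℤ) / (d : ℤ)) : ℤ) : ZMod (Nat.gcd d (N / d))) =
    (((u : ZMod (Nat.gcd d (N / d))).val : ℤ) : ZMod (Nat.gcd d (N / d)))
  rw [Int.ediv_self (by exact_mod_cast hd0), mul_one, ← hv, ZMod.unitsMap_def]
  push_cast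
  rw [ZMod.natCast_zmod_val, Units.coe_map, MonoidHom.coe_coe, ZMod.castHom_apply,
    ZMod.cast_eq_val]

end Invariant

/-! ### Cusp orbits of `Γ₀(N)` and the count -/

section Cusps

variable (N : ℕ) [NeZero N]

/-- The cusp `g ∞ = a/c ∈ ℙ¹(ℚ) ⊆ ℙ¹(ℝ)` of `Γ₀(N)`, for `g = (a b; c d₀) ∈ SL₂(ℤ)`, as an element
of Mathlib's set of cusps of the image `𝒢` of `Γ₀(N)` in `GL(2, ℝ)` (every element of `ℙ¹(ℚ)` is
a cusp of the arithmetic group `𝒢`, Mathlib `isCusp_SL2Z_iff'`; Diamond–Shurman §2.4, §3.8).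
[folklore] -/
def cuspOf (g : SL(2, ℤ)) : cuspsSubMulAction (Gamma0 N : Subgroup (GL (Fin 2) ℝ)) :=
  ⟨mapGL ℝ g • ∞, (Subgroup.IsArithmetic.isCusp_iff_isCusp_SL2Z _).mpr
    (isCusp_SL2Z_iff'.mpr ⟨g, rfl⟩)⟩

/-- The cusp orbit `Γ₀(N) g ∞ ∈ Γ₀(N) \ ℙ¹(ℚ)` (Mathlib `CuspOrbits`). [folklore] -/
def cuspOrbitOf (g : SL(2, ℤ)) : CuspOrbits (Gamma0 N : Subgroup (GL (Fin 2) ℝ)) :=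
  Quotient.mk _ (cuspOf N g)

/-- Every cusp orbit of `Γ₀(N)` is `Γ₀(N) g ∞` for some `g ∈ SL₂(ℤ)` (the cusps of an arithmetic
group are the `SL₂(ℤ)`-translates of `∞`; Diamond–Shurman §2.4). [folklore] -/
theorem cuspOrbitOf_surjective : Function.Surjective (cuspOrbitOf N) := by
  rintro ⟨c, hc⟩
  have hc' : IsCusp c (Gamma0 N : Subgroup (GL (Fin 2) ℝ)) := hc
  rw [Subgroup.IsArithmetic.isCusp_iff_isCusp_SL2Z, isCusp_SL2Z_iff'] at hc'
  obtain ⟨g, rfl⟩ := hc'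
  exact ⟨g, rfl⟩

omit [NeZero N] in
/-- `x ∞ = ∞` iff `c = 0`, for `x = (a b; c d₀) ∈ SL₂(ℤ)` acting on `ℙ¹(ℝ)` through `GL(2, ℝ)`
(Diamond–Shurman Lemma 3.8.1). [folklore] -/
theorem mapGL_smul_infty_eq_self_iff (x : SL(2, ℤ)) :
    mapGL ℝ x • (∞ : OnePoint ℝ) = ∞ ↔ x 1 0 = 0 := by
  rw [OnePoint.smul_infty_eq_self_iff]
  simp

/-- `Γ₀(N) g ∞ = Γ₀(N) g' ∞` iff `g⁻¹ γ g' ∞ = ∞` for some `γ ∈ Γ₀(N)`, i.e. iff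
`g' ∈ Γ₀(N) g SL₂(ℤ)_∞` (Diamond–Shurman Lemma 3.8.1, §3.8). [folklore] -/
theorem cuspOrbitOf_eq_iff (g g' : SL(2, ℤ)) :
    cuspOrbitOf N g = cuspOrbitOf N g' ↔ ∃ γ ∈ Gamma0 N, (g⁻¹ * γ * g') 1 0 = 0 := by
  rw [cuspOrbitOf, cuspOrbitOf, Quotient.eq, MulAction.orbitRel_apply, MulAction.mem_orbit_iff]
  constructor
  · rintro ⟨⟨_, γ, hγ, rfl⟩, h⟩
    refine ⟨γ, hγ, ?_⟩
    have h' := congrArg Subtype.val h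
    change mapGL ℝ γ • mapGL ℝ g' • (∞ : OnePoint ℝ) = mapGL ℝ g • ∞ at h'
    rwa [← mul_smul, ← inv_smul_eq_iff, ← mul_smul, ← map_inv, ← map_mul, ← map_mul,
      mapGL_smul_infty_eq_self_iff, ← mul_assoc] at h'
  · rintro ⟨γ, hγ, h⟩
    refine ⟨⟨mapGL ℝ γ, Subgroup.mem_map_of_mem (mapGL ℝ) hγ⟩, Subtype.ext ?_⟩
    change mapGL ℝ γ • mapGL ℝ g' • (∞ : OnePoint ℝ) = mapGL ℝ g • ∞
    rwa [← mul_smul, ← inv_smul_eq_iff, ← mul_smul, ← map_inv, ← map_mul, ← map_mul,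
      mapGL_smul_infty_eq_self_iff, ← mul_assoc]

/-- **Cusp orbits are classified by the invariant**: `Γ₀(N) g ∞ = Γ₀(N) g' ∞` iff
`cuspInv N g = cuspInv N g'` (Diamond–Shurman Prop. 3.8.3 and §3.8, p. 103).
[cite: DiamondShurman2005, Prop. 3.8.3] -/
theorem cuspOrbitOf_eq_iff_cuspInv_eq (g g' : SL(2, ℤ)) :
    cuspOrbitOf N g = cuspOrbitOf N g' ↔ cuspInv N g = cuspInv N g' := by
  rw [cuspOrbitOf_eq_iff]
  constructor
  · rintro ⟨γ, hγ, h⟩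
    have : g' = γ⁻¹ * (g * (g⁻¹ * γ * g')) := by group
    rw [this, cuspInv_mul_left N (inv_mem hγ), cuspInv_mul_right N g h]
  · exact exists_mem_gamma0_of_cuspInv_eq N

/-- **The cusps of `Γ₀(N)` are in bijection with `∐_{d ∣ N} (ℤ/gcd(d, N/d)ℤ)ˣ`**
(Diamond–Shurman §3.8, p. 103; Shimura Prop. 1.43): both are quotients of `SL₂(ℤ)` by the same
relation. [cite: DiamondShurman2005, §3.8] -/
def cuspOrbitsEquiv : CuspOrbits (Gamma0 N : Subgroup (GL (Fin 2) ℝ)) ≃ CuspIndex N :=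
  ((Setoid.quotientKerEquivOfSurjective _ (cuspOrbitOf_surjective N)).symm.trans
    (Quotient.congrRight fun g g' ↦ by
      change cuspOrbitOf N g = cuspOrbitOf N g' ↔ cuspInv N g = cuspInv N g'
      exact cuspOrbitOf_eq_iff_cuspInv_eq N g g')).trans
    (Setoid.quotientKerEquivOfSurjective _ (cuspInv_surjective N))

/-- **Number of cusps of `Γ₀(N)`** (discharge of the fact `numCusps_eq_nuInfty` of
`ModularCurve.lean`): `ε_∞(Γ₀(N)) = ∑_{d ∣ N} φ(gcd(d, N/d))` for `N ≥ 1` (Shimura Prop. 1.43,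
second assertion; Diamond–Shurman §3.8, p. 103). The fact is `ℕ → Prop` (its `[NeZero N]`
section variable is not part of the statement) and is false at `N = 0` (`Γ₀(0) = SL₂(ℤ)_∞` has
the single cusp `∞` while `nuInfty 0 = 0`), so the discharge assumes `[NeZero N]`, as the source
does. [cite: ShimuraIATAF1971, Prop. 1.43] -/
theorem numCusps_eq_nuInfty_holds : numCusps_eq_nuInfty N := by
  unfold numCusps_eq_nuInfty numCusps
  rw [Nat.card_congr (cuspOrbitsEquiv N), card_cuspIndex]

end Cusps

end Literature.NumberTheory.EllipticCurves.ModularForms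

end
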